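import Summits.RiemannHypothesis.RiemannHypothesis.Theorems.SoloInformedQuasiWeil

/-!
# The thermometer per test function; Weil's functional on dipoles; the dichotomy

Solo programme `solo-RiemannHypothesis-informed`, session 2 — corollaries rounding off the exact
thermometer (`SoloInformedQuasiWeil.lean`).

* `width_iff_forall_norm_expSum_le` — **per test function, no loss in the exponent**: for every real
  `Θ`, all non-trivial zeros satisfy `|Re ρ - 1/2| ≤ Θ/2` iff for every test `g` the generalised
  Dirichlet series `B_g(x) = ∑_ρ m(ρ) ĝ(ρ) conj ĝ(1-ρ̄) e^{(ρ-1/2)x}` is `O_g(e^{Θ x/2})` on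
  `x ≥ 0`. In particular `riemannHypothesis_iff_forall_expSum_bounded`: RH iff every `B_g` is
  bounded on `[0, ∞)`.
* `two_mul_expSum_eq` — what `B_g` is on the PRIME side: by polarisation and the explicit formula,
  `2 B_g(x) = (Q(g + g_x) - 2Q(g)) - i (Q(g + i g_x) - 2Q(g))` with `Q = weilQuadratic` (Weil's
  functional of `φ ⋆ φ̃`) and `g_x = g(· - x)`. So RH is EQUIVALENT to the boundedness of Weil's
  functional along the translation dipoles `g + c g_x` (`|c| = 1`, `x ≥ 0`) of each single test
  function (`riemannHypothesis_iff_weilQuadratic_dipole_bounded`): the content of Weil's criterion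
  that the Riemann hypothesis needs lives on dipoles, where it is the smoothed von Koch estimate.
* `riemannHypothesis_iff_weilGroundEnergy_bddBelow`, `weilGroundEnergy_dichotomy` — there is no
  middle ground for the ground energy `ε(a)`: either `ε(a) ≥ 0` for all `a > 0` (RH), or `ε(a)` is
  exponentially negative at some positive rate along a sequence `a → ∞` (not RH).
-/

noncomputable section

open Complex Filter Set MeasureTheory
open scoped Real Topology ComplexConjugate

namespace Summit.RiemannHypothesis.RiemannHypothesis.Theorems

open Literature.NumberTheory.LFunctions Literature.NumberTheory.LFunctions.WeilConverse

variable {g : ℝ → ℂ}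

/-! ## Width `Θ` ⟹ `B_g(x) = O_g(e^{Θ x / 2})` -/

/-- Under the strip bound `|Re ρ - 1/2| ≤ Θ/2`, for every test `g` and `x ≥ 0`:
`‖B_g(x)‖ ≤ (∑_ρ m(ρ)|P_g(ρ)|) e^{Θ x/2}` (termwise, absolute convergence of `Q(g)`). -/
theorem norm_expSum_le_of_width {Θ : ℝ}
    (hΘ : ∀ ρ ∈ ZetaZeros.riemannZetaNontrivialZeros, |ρ.re - 1 / 2| ≤ Θ / 2)
    (hg : IsWeilTest g) {x : ℝ} (hx : 0 ≤ x) :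
    ‖expSum g x‖ ≤ (∑' ρ : ZetaZeros.riemannZetaNontrivialZeros,
        ‖(riemannZetaZeroOrder (ρ : ℂ) : ℂ) * pairCoeff g ρ‖) * Real.exp (Θ / 2 * x) := by
  have hs := summable_norm_pairCoeff hg
  have hS := summable_expSum hg x
  rw [expSum, ← tsum_mul_right]
  refine (norm_tsum_le_tsum_norm hS.norm).trans ?_
  refine Summable.tsum_le_tsum (fun ρ ↦ ?_) hS.norm (hs.mul_right _)
  rw [norm_mul, Complex.norm_exp]
  refine mul_le_mul_of_nonneg_left (Real.exp_le_exp.2 ?_) (norm_nonneg _)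
  have hre : (((ρ : ℂ) - 1 / 2) * x).re = ((ρ : ℂ).re - 1 / 2) * x := by
    rw [Complex.re_mul_ofReal]
    simp [sub_re]
  rw [hre]
  exact mul_le_mul_of_nonneg_right ((le_abs_self _).trans (hΘ ρ ρ.2)) hx

/-! ## `B_g(x) = O(e^{κ x})` ⟹ no zero with `Re ρ - 1/2 > κ` seen by `g` -/

/-- **Fibre vanishing from a growth bound on `B_g` alone.** If `‖B_g(x)‖ ≤ M e^{κ x}` for
`x ≥ 0`, then `m(ρ₀) P_g(ρ₀) = 0` at every non-trivial zero with `Re ρ₀ - 1/2 > κ` (the tilted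
bounded-power-sum lemma `sum_fiber_eq_zero_of_exp_growth`; the fibre of `ρ₀ - 1/2` is `{ρ₀}`). -/
theorem order_mul_pairCoeff_eq_zero_of_norm_expSum_le (hg : IsWeilTest g) {κ M : ℝ}
    (hM : ∀ x : ℝ, 0 ≤ x → ‖expSum g x‖ ≤ M * Real.exp (κ * x))
    {ρ₀ : ℂ} (hρ₀ : ρ₀ ∈ ZetaZeros.riemannZetaNontrivialZeros) (hre : κ < ρ₀.re - 1 / 2) :
    (riemannZetaZeroOrder ρ₀ : ℂ) * pairCoeff g ρ₀ = 0 := by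
  have h := sum_fiber_eq_zero_of_exp_growth (ι := ZetaZeros.riemannZetaNontrivialZeros)
    (c := fun ρ ↦ (riemannZetaZeroOrder (ρ : ℂ) : ℂ) * pairCoeff g ρ)
    (lam := fun ρ ↦ (ρ : ℂ) - 1 / 2) (R := 1 / 2) (M := M)
    (summable_norm_pairCoeff hg) (fun ρ ↦ (le_abs_self _).trans (abs_re_sub_half_le ρ.2))
    (fun z ↦ ?_) (κ := κ) (fun x hx ↦ hM x hx)
    (μ := ρ₀ - 1 / 2) (by simpa [sub_re] using hre) {⟨ρ₀, hρ₀⟩} (fun ρ ↦ ?_)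
  · simpa using h
  · refine ⟨1, one_pos, ?_⟩
    refine ((riemannZetaNontrivialZeros_finite_inter_ball (z + 1 / 2) 1).preimage
      (Subtype.val_injective.injOn)).subset fun ρ hρ ↦ ?_
    simp only [mem_setOf_eq, Metric.mem_ball, dist_eq_norm] at hρ
    refine ⟨ρ.2, ?_⟩
    rw [Metric.mem_ball, dist_eq_norm]
    rwa [show (ρ : ℂ) - (z + 1 / 2) = (ρ : ℂ) - 1 / 2 - z by ring]
  · rw [Finset.mem_singleton, sub_left_inj]
    constructor
    · rintro rfl; rfl
    · intro h; exact Subtype.ext h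

/-- **One-sided strip bound from growth bounds on the `B_g`.** If every test `g` has
`‖B_g(x)‖ ≤ M_g e^{Θ x/2}` on `x ≥ 0`, then `Re ρ - 1/2 ≤ Θ/2` for every non-trivial zero (test the
hypothesis on a narrow bump with `Re ĝ > 0` on the horizontal line through `ρ` and `1 - ρ̄`). -/
theorem re_sub_half_le_of_forall_norm_expSum_le {Θ : ℝ}
    (H : ∀ g : ℝ → ℂ, IsWeilTest g →
      ∃ M : ℝ, ∀ x : ℝ, 0 ≤ x → ‖expSum g x‖ ≤ M * Real.exp (Θ / 2 * x))
    {ρ : ℂ} (hρ : ρ ∈ ZetaZeros.riemannZetaNontrivialZeros) : ρ.re - 1 / 2 ≤ Θ / 2 := by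
  by_contra hre
  push Not at hre
  obtain ⟨g, hg, hpos⟩ := exists_isWeilTest_re_weilMellin_pos ρ.im
  obtain ⟨M, hM⟩ := H g hg
  have h := order_mul_pairCoeff_eq_zero_of_norm_expSum_le hg hM hρ hre
  have hm : (riemannZetaZeroOrder ρ : ℂ) ≠ 0 := by
    have := ZetaZeros.riemannZetaNontrivialZeros.one_le_order hρ
    exact_mod_cast (by omega : riemannZetaZeroOrder ρ ≠ 0)
  have h1 : weilMellin g ρ ≠ 0 := by
    intro h0
    have := hpos ρ.re
    rw [show (ρ.re : ℂ) + ρ.im * I = ρ from Complex.re_add_im ρ, h0, Complex.zero_re] at this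
    exact lt_irrefl _ this
  have h2 : weilMellin g (1 - conj ρ) ≠ 0 := by
    intro h0
    have := hpos (1 - ρ.re)
    rw [show ((1 - ρ.re : ℝ) : ℂ) + ρ.im * I = 1 - conj ρ from ?_, h0, Complex.zero_re] at this
    · exact lt_irrefl _ this
    · apply Complex.ext <;> simp
  exact (mul_ne_zero hm (mul_ne_zero h1 ((map_ne_zero _).2 h2))) h

/-- **Strip bound from growth bounds on the `B_g`** (one-sided bound at `ρ` and at `1 - ρ̄`). -/
theorem width_of_forall_norm_expSum_le {Θ : ℝ}
    (H : ∀ g : ℝ → ℂ, IsWeilTest g →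
      ∃ M : ℝ, ∀ x : ℝ, 0 ≤ x → ‖expSum g x‖ ≤ M * Real.exp (Θ / 2 * x))
    {ρ : ℂ} (hρ : ρ ∈ ZetaZeros.riemannZetaNontrivialZeros) : |ρ.re - 1 / 2| ≤ Θ / 2 := by
  have h1 := re_sub_half_le_of_forall_norm_expSum_le H hρ
  have h2 := re_sub_half_le_of_forall_norm_expSum_le H
    (ZetaZeros.riemannZetaNontrivialZeros.one_sub_conj_mem hρ)
  rw [one_sub_conj_re] at h2
  rw [abs_le]
  constructor <;> linarith

/-- **The thermometer per test function (exact, every `Θ`).** All non-trivial zeros lie in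
`|Re s - 1/2| ≤ Θ/2` iff for every test function `g` the series
`B_g(x) = ∑_ρ m(ρ) ĝ(ρ) conj ĝ(1 - ρ̄) e^{(ρ - 1/2) x}` satisfies `‖B_g(x)‖ ≤ M_g e^{Θ x/2}` for
`x ≥ 0`. No `ε` is lost and the constant may depend on `g`. -/
theorem width_iff_forall_norm_expSum_le {Θ : ℝ} :
    (∀ ρ ∈ ZetaZeros.riemannZetaNontrivialZeros, |ρ.re - 1 / 2| ≤ Θ / 2) ↔
      ∀ g : ℝ → ℂ, IsWeilTest g →
        ∃ M : ℝ, ∀ x : ℝ, 0 ≤ x → ‖expSum g x‖ ≤ M * Real.exp (Θ / 2 * x) :=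
  ⟨fun hΘ _ hg ↦ ⟨_, fun _ hx ↦ norm_expSum_le_of_width hΘ hg hx⟩,
    fun H _ hρ ↦ width_of_forall_norm_expSum_le H hρ⟩

/-- **RH iff every `B_g` is bounded on `[0, ∞)`.** -/
theorem riemannHypothesis_iff_forall_expSum_bounded :
    RiemannHypothesis ↔
      ∀ g : ℝ → ℂ, IsWeilTest g → ∃ M : ℝ, ∀ x : ℝ, 0 ≤ x → ‖expSum g x‖ ≤ M := by
  have key := width_iff_forall_norm_expSum_le (Θ := 0)
  simp only [zero_div, zero_mul, Real.exp_zero, mul_one, abs_nonpos_iff, sub_eq_zero] at key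
  rw [← key]
  constructor
  · intro h ρ hρ
    obtain ⟨hs, h0, h1⟩ := ZetaZeros.riemannZetaNontrivialZeros.mem_iff'.1 hρ
    exact riemannHypothesis_iff_strip_holds.1 h ρ hs h0 h1
  · intro h
    exact riemannHypothesis_iff_strip_holds.2 fun s hs h0 h1 ↦
      h s (ZetaZeros.riemannZetaNontrivialZeros.mem_iff'.2 ⟨hs, h0, h1⟩)

/-! ## What `B_g` is on the prime side: Weil's functional on two dipoles -/

/-- **Polarisation.** `2 B_g(x) = (Q(g + g_x) - 2 Q(g)) - i (Q(g + i g_x) - 2 Q(g))`, where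
`Q = weilQuadratic` is Weil's functional of `φ ⋆ φ̃` (prime and archimedean side) and
`g + c g_x = translateMix g c x`: by `zeroForm_translateMix` and the explicit formula
`zeroForm = weilQuadratic`. -/
theorem two_mul_expSum_eq (hg : IsWeilTest g) (x : ℝ) :
    2 * expSum g x =
      (weilQuadratic (translateMix g 1 x) - 2 * weilQuadratic g) -
        I * (weilQuadratic (translateMix g I x) - 2 * weilQuadratic g) := by
  have e1 := zeroForm_translateMix hg 1 x
  have eI := zeroForm_translateMix hg I x
  rw [combShapeDetection_zeroForm_eq_weilQuadratic (isWeilTest_translateMix hg 1 x)] at e1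
  rw [combShapeDetection_zeroForm_eq_weilQuadratic (isWeilTest_translateMix hg I x)] at eI
  rw [combShapeDetection_zeroForm_eq_weilQuadratic hg] at e1 eI
  simp only [map_one, Complex.ofReal_one, one_mul, Complex.conj_I, Complex.normSq_I] at e1 eI
  linear_combination -e1 + I * eI + (expSum g x - expSum' g x) * Complex.I_sq

/-- Weil's functional on a dipole is controlled by `B_g`:
`‖Q(g + c g_x)‖ ≤ 2 ‖Q(g)‖ + 2 ‖B_g(x)‖` for `‖c‖ ≤ 1` (from
`Q(g + c g_x) = (1 + |c|²) Q(g) + conj c · A_g(x) + c · B_g(x)` and `‖A_g‖ = ‖B_g‖`). -/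
theorem norm_weilQuadratic_translateMix_le (hg : IsWeilTest g) {c : ℂ} (hc : ‖c‖ ≤ 1) (x : ℝ) :
    ‖weilQuadratic (translateMix g c x)‖ ≤ 2 * ‖weilQuadratic g‖ + 2 * ‖expSum g x‖ := by
  have e := zeroForm_translateMix hg c x
  rw [combShapeDetection_zeroForm_eq_weilQuadratic (isWeilTest_translateMix hg c x),
    combShapeDetection_zeroForm_eq_weilQuadratic hg] at e
  rw [e]
  have hA : ‖expSum' g x‖ = ‖expSum g x‖ := by rw [← conj_expSum' g x, Complex.norm_conj]
  have hc2 : ‖(Complex.normSq c : ℂ)‖ ≤ 1 := by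
    rw [Complex.norm_real, Real.norm_eq_abs, abs_of_nonneg (Complex.normSq_nonneg c),
      Complex.normSq_eq_norm_sq]
    nlinarith [norm_nonneg c]
  have hc1 : ‖(starRingEnd ℂ) c‖ ≤ 1 := by rwa [Complex.norm_conj]
  calc ‖weilQuadratic g + (↑(Complex.normSq c) * weilQuadratic g +
          ((starRingEnd ℂ) c * expSum' g x + c * expSum g x))‖
      ≤ ‖weilQuadratic g‖ + (‖↑(Complex.normSq c) * weilQuadratic g‖ +
          (‖(starRingEnd ℂ) c * expSum' g x‖ + ‖c * expSum g x‖)) :=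
        (norm_add_le _ _).trans (add_le_add le_rfl ((norm_add_le _ _).trans
          (add_le_add le_rfl (norm_add_le _ _))))
    _ ≤ ‖weilQuadratic g‖ + (1 * ‖weilQuadratic g‖ + (1 * ‖expSum g x‖ + 1 * ‖expSum g x‖)) := by
        rw [norm_mul, norm_mul, norm_mul, hA]
        gcongr
    _ = 2 * ‖weilQuadratic g‖ + 2 * ‖expSum g x‖ := by ring

/-- **RH iff Weil's functional is bounded along the translation dipoles of each test function**:
`RH ↔ ∀ g test, ∃ M, ∀ x ≥ 0, ∀ c, ‖c‖ ≤ 1 → ‖Q(g + c g_x)‖ ≤ M`. (`→`: `‖Q(g + c g_x)‖ ≤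
2‖Q(g)‖ + 2‖B_g(x)‖` and `B_g` is bounded; `←`: the dipoles `c = 1, i` recover `B_g`.) -/
theorem riemannHypothesis_iff_weilQuadratic_dipole_bounded :
    RiemannHypothesis ↔
      ∀ g : ℝ → ℂ, IsWeilTest g → ∃ M : ℝ, ∀ x : ℝ, 0 ≤ x → ∀ c : ℂ, ‖c‖ ≤ 1 →
        ‖weilQuadratic (translateMix g c x)‖ ≤ M := by
  rw [riemannHypothesis_iff_forall_expSum_bounded]
  constructor
  · intro h g hg
    obtain ⟨M, hM⟩ := h g hg
    exact ⟨2 * ‖weilQuadratic g‖ + 2 * M, fun x hx c hc ↦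
      (norm_weilQuadratic_translateMix_le hg hc x).trans (by linarith [hM x hx])⟩
  · intro h g hg
    obtain ⟨M, hM⟩ := h g hg
    refine ⟨(M + 2 * ‖weilQuadratic g‖ + (M + 2 * ‖weilQuadratic g‖)) / 2, fun x hx ↦ ?_⟩
    have h1 := hM x hx 1 (by simp)
    have hI := hM x hx I (by simp)
    have e := two_mul_expSum_eq hg x
    have h2 : ‖(2 : ℂ) * expSum g x‖ = 2 * ‖expSum g x‖ := by
      rw [norm_mul]; norm_num
    have hb : ‖(2 : ℂ) * expSum g x‖ ≤ M + 2 * ‖weilQuadratic g‖ + (M + 2 * ‖weilQuadratic g‖) := by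
      rw [e]
      refine (norm_sub_le _ _).trans (add_le_add ?_ ?_)
      · refine (norm_sub_le _ _).trans ?_
        rw [norm_mul]; norm_num; linarith
      · rw [norm_mul, Complex.norm_I, one_mul]
        refine (norm_sub_le _ _).trans ?_
        rw [norm_mul]; norm_num; linarith
    linarith

/-! ## The dichotomy for the ground energy -/

/-- **RH iff the ground energy is bounded below**: `RH ↔ ∃ C, ∀ a > 0, ε(a) ≥ -C`
(a constant slack is subexponential slack). -/
theorem riemannHypothesis_iff_weilGroundEnergy_bddBelow :
    RiemannHypothesis ↔ ∃ C : ℝ, ∀ a : ℝ, 0 < a → -C ≤ weilGroundEnergy a := by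
  constructor
  · exact fun h ↦ ⟨0, fun a ha ↦ by simpa using weilGroundEnergy_nonneg_of_riemannHypothesis h ha⟩
  · rintro ⟨C, hC⟩
    refine riemannHypothesis_iff_weilGroundEnergy_subexp.2 fun κ hκ ↦ ⟨max C 0, fun a ha ↦ ?_⟩
    have h1 : (1 : ℝ) ≤ Real.exp (κ * a) := Real.one_le_exp (by positivity)
    have h2 : 0 ≤ max C 0 * (Real.exp (κ * a) - 1) := mul_nonneg (le_max_right C 0) (by linarith)
    have h3 := hC a ha
    nlinarith [le_max_left C 0]

/-- **No middle ground.** Either `ε(a) ≥ 0` for every `a > 0` (equivalently RH), or there is a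
rate `κ > 0` such that for every `C`, `ε(a) < -C e^{κ a}` for arbitrarily large `a`: Weil's ground
energy is never negative-but-subexponential. -/
theorem weilGroundEnergy_dichotomy :
    (∀ a : ℝ, 0 < a → 0 ≤ weilGroundEnergy a) ∨
      ∃ κ : ℝ, 0 < κ ∧ ∀ C : ℝ, ∃ᶠ a in atTop, weilGroundEnergy a < -(C * Real.exp (κ * a)) := by
  by_cases h : RiemannHypothesis
  · exact Or.inl fun a ha ↦ weilGroundEnergy_nonneg_of_riemannHypothesis h ha
  · exact Or.inr (exists_frequently_weilGroundEnergy_lt_of_not_riemannHypothesis h)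

/-- The same dichotomy for Weil's functional itself: either `Re Q(g) ≥ 0` for every test `g`, or some
single test function `g` has `B_g` (equivalently, by `two_mul_expSum_eq`, Weil's functional along
its dipoles) unbounded on `[0, ∞)`. -/
theorem weilQuadratic_dichotomy :
    (∀ g : ℝ → ℂ, IsWeilTest g → 0 ≤ (weilQuadratic g).re) ∨
      ∃ g : ℝ → ℂ, IsWeilTest g ∧ ∀ M : ℝ, ∃ x : ℝ, 0 ≤ x ∧ M < ‖expSum g x‖ := by
  by_cases h : RiemannHypothesis
  · refine Or.inl fun g hg ↦ ?_
    obtain ⟨b, hb, hsupp⟩ := exists_tsupport_subset_Icc hg.2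
    exact riemannHypothesis_iff_forall_weilPositivityOn.1 h (b + 1) (by linarith) g hg
      (hsupp.trans (Icc_subset_Icc (by linarith) (by linarith)))
  · right
    by_contra H
    push Not at H
    exact h (riemannHypothesis_iff_forall_expSum_bounded.2 fun g hg ↦
      let ⟨M, hM⟩ := H g hg; ⟨M, hM⟩)

end Summit.RiemannHypothesis.RiemannHypothesis.Theorems
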